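import Literature.NumberTheory.IwasawaTheory.Fukuda1994Thm1RankLayer
import Literature.NumberTheory.IwasawaTheory.ZpExtensionLayerRamificationDichotomy
import Literature.NumberTheory.IwasawaTheory.ZpExtensionLayerTotallyRamifiedPrime
import Literature.NumberTheory.EllipticCurves.ZpExtensionLayerCharacter
import Literature.NumberTheory.NumberFields.HilbertClassFieldArtinEquivariance
import HarnessLib

/-!
# Fukuda 1994, Theorem 1 at finite level — the PACKAGE WITH THE EXACT AMBIGUOUS-CLASS COUNT: `Gal(H_p(K_{n+t})/K_n)`, its abelian normal subgroup
# `A = Gal(H_p/K_{n+t})`, a totally ramified inertia generator `g`, the inertia family, the index/rank data of every layer, AND the EQUALITY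
# «`#{a ∈ A : g a g⁻¹ = a} = p^{v_p #Cl(K_{n+t})^{⟨σ⟩}}`», `σ = g|_{K_{n+t}}` generating `Gal(K_{n+t}/K_n)` — both bounds on the abstract fixed points

Topic `NumberTheory/IwasawaTheory` (namespace = path). THEOREM-ONLY file (no definition, no named fact, no `sorry`), written by the prover
seat `bsd-line-att-p3` g47 (cell `bsd-f1-sign2`, route `AlignedTransportAtTwo`; `--supports` stmt-BirchSwinnertonDyer-22298; closes nothing).
It is the package `Fukuda1994Thm1RankPackageFixed.exists_layer_package_fixed` of this lineage's g42 VERBATIM (same construction of `T = K_{n+t}`, `B = K_n`,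
`H_T`, `A`, `A₀`, `H_p = HqF`, `G = Gal(H_p/B)`, `A'`, the inertia groups, `g`, `𝓘`; same proof, line by line), with ONE strengthening: the Artin count is exported as
an EQUALITY.  g42's file recorded only `p^{v_p #Cl^σ} ≤ #A^g` (the Sylow `p`-subgroup of the `σ`-fixed classes EMBEDS into the `g`-fixed part of `A`); but the Artin map
`Cl(K_{n+t}) ↠ A` has kernel of order prime to `p` and is equivariant, so its restriction to `p`-primary classes is a BIJECTION onto `A` carrying `σ`-fixed classes
exactly onto `g`-fixed elements (`natCard_fixed_eq_pow_padicValNat`: a `g`-fixed `a = θ(c)` has a `p`-primary preimage `c`, and `αc·c⁻¹` lies in `ker θ` and is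
`p`-primary, hence trivial).  So **`#{a ∈ A : g a g⁻¹ = a} = p ^ v_p #{c ∈ Cl(K_{n+t}) : σc = c}`** — the UPPER bound on the abstract side that every
«depth»-type door needs (`#A/(φ−1)A = #A^g` bounded by a Chevalley / genus count of AMBIGUOUS CLASSES), which the lineage so far had to obtain at class-group level
one pair of layers at a time (g42 depth door, g46 pro-cyclic door).  A fifth copy of the 400-line construction is the price (the original's `G` is hidden behind `∃`).

Consumer (same seat): `ClassGroupPRankLeOfNotElementaryLayerSubOne` — the elementary-layer door over a base with `ord_p h_K = 1` (`Y₀ = TA` from `#A/TA = #A^g ≤ p`).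

References: [Fukuda1994] Thm. 1, p. 264; [Washington1997] §13.3 Lemmas 13.14–13.18, Prop. 13.22; Lemma 13.3; [Lang1990] Ch. 3 §4, Ch. 13 §4;
[Cox2013] §8.A Thm. 8.10; [NeukirchANT1999] Ch. IV §6, Ch. VI §7 Thm. (7.1).
-/

noncomputable section

open scoped NumberField IsMulCommutative
open NumberField IsDedekindDomain Field IntermediateField

namespace Literature.NumberTheory.IwasawaTheory

open Literature.NumberTheory.EllipticCurves Literature.NumberTheory.GaloisRepresentations
  Literature.NumberTheory.NumberFields

/-! ## §1 Fixed points of an equivariant surjection with kernel prime to `p`; the equivariant Artin map -/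

section Fixed

/-- **Fixed points correspond EXACTLY along an equivariant hom with kernel prime to `p`.**  `θ : C → H` a hom from a finite abelian group onto the
subgroup `A` of order `p^{v_p #C}` (so `#ker θ` is prime to `p`), `α ∈ Aut C`, `h ∈ H` with `θ(αc) = h θ(c) h⁻¹`.  Then `θ` maps the Sylow `p`-subgroup of
`C^α` BIJECTIVELY onto `{a ∈ A : h a h⁻¹ = a}`: injective as in g42's file, surjective because a `h`-fixed `a` has a `p`-primary preimage `c` (`c₀^{N·u}`,
`N = #ker θ`, `N·u ≡ 1 (mod p^{v_p #C})`) and `αc·c⁻¹ ∈ ker θ` is `p`-primary, hence `1`.  So `#A^h = p^{v_p #C^α}`. [folklore] -/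
private theorem natCard_fixed_eq_pow_padicValNat {C H : Type*} [CommGroup C] [Finite C] [Group H] [Finite H]
    (θ : C →* H) (A : Subgroup H) (hA : θ.range = A) {p : ℕ} [hp : Fact p.Prime]
    (hcard : Nat.card A = p ^ padicValNat p (Nat.card C))
    (α : C ≃* C) (h : H) (heq : ∀ c, θ (α c) = h * θ c * h⁻¹) :
    Nat.card {a : A // h * (a : H) * h⁻¹ = a} = p ^ padicValNat p (Nat.card {c : C // α c = c}) := by
  classical
  let FixC : Subgroup C :=
    { carrier := {c | α c = c}
      mul_mem' := fun {a b} ha hb => by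
        simp only [Set.mem_setOf_eq] at ha hb ⊢
        rw [map_mul, ha, hb]
      one_mem' := by simp
      inv_mem' := fun {a} ha => by
        simp only [Set.mem_setOf_eq] at ha ⊢
        rw [map_inv, ha] }
  have hFixC : Nat.card FixC = Nat.card {c : C // α c = c} :=
    Nat.card_congr (Equiv.subtypeEquivRight fun _ => Iff.rfl)
  obtain ⟨P⟩ : Nonempty (Sylow p FixC) := inferInstance
  have hP : Nat.card P = p ^ padicValNat p (Nat.card {c : C // α c = c}) := by
    rw [P.card_eq_multiplicity, Nat.factorization_def _ hp.out, hFixC]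
  have hker : ¬ p ∣ Nat.card θ.ker := by
    have h1 : θ.ker.index * Nat.card θ.ker = Nat.card C := θ.ker.index_mul_card
    rw [Subgroup.index_ker, hA, hcard] at h1
    intro hdvd
    have h2 : p ^ (padicValNat p (Nat.card C) + 1) ∣ Nat.card C := by
      have h3 : p ^ (padicValNat p (Nat.card C) + 1) ∣ p ^ padicValNat p (Nat.card C) * Nat.card θ.ker := by
        rw [pow_succ]; exact mul_dvd_mul_left _ hdvd
      rwa [h1] at h3
    exact pow_succ_padicValNat_not_dvd (Nat.card_pos (α := C)).ne' h2
  have hmemA : ∀ c : C, θ c ∈ A := fun c => by rw [← hA]; exact ⟨c, rfl⟩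
  let f : P → {a : A // h * (a : H) * h⁻¹ = a} := fun x =>
    ⟨⟨θ ((x : FixC) : C), hmemA _⟩, by
      have hx : α ((x : FixC) : C) = ((x : FixC) : C) := (x : FixC).2
      change h * θ ((x : FixC) : C) * h⁻¹ = θ ((x : FixC) : C)
      rw [← heq, hx]⟩
  have hf : Function.Injective f := by
    intro x y hxy
    have h1 : θ ((x : FixC) : C) = θ ((y : FixC) : C) := by
      have := congrArg (fun z : {a : A // h * (a : H) * h⁻¹ = a} => ((z : A) : H)) hxy
      exact this
    set z : P := x * y⁻¹ with hz
    have hzC : (((z : FixC) : C)) = ((x : FixC) : C) * (((y : FixC) : C))⁻¹ := by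
      rw [hz]; rfl
    have hzker : ((z : FixC) : C) ∈ θ.ker := by
      rw [MonoidHom.mem_ker, hzC, map_mul, map_inv, h1, mul_inv_cancel]
    obtain ⟨k, hk⟩ := P.isPGroup' z
    have hkC : (((z : FixC) : C)) ^ p ^ k = 1 := by
      have := congrArg (fun w : P => (((w : FixC) : C))) hk
      simpa using this
    have hord1 : orderOf ((z : FixC) : C) ∣ p ^ k := orderOf_dvd_of_pow_eq_one hkC
    have hord2 : orderOf ((z : FixC) : C) ∣ Nat.card θ.ker := Subgroup.orderOf_dvd_natCard θ.ker hzker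
    have hcop : Nat.Coprime (p ^ k) (Nat.card θ.ker) :=
      Nat.Coprime.pow_left k ((Nat.Prime.coprime_iff_not_dvd hp.out).mpr hker)
    have hone : orderOf ((z : FixC) : C) = 1 :=
      Nat.Coprime.eq_one_of_dvd (Nat.Coprime.coprime_dvd_left hord1 hcop) hord2
    rw [orderOf_eq_one_iff, hzC, mul_inv_eq_one] at hone
    exact Subtype.ext (Subtype.ext hone)
  -- surjectivity: a `p`-primary preimage of an `h`-fixed element is `α`-fixed
  have hsurj : Function.Surjective f := by
    intro a
    set v := padicValNat p (Nat.card C) with hv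
    set N := Nat.card θ.ker with hN
    have hNC : p ^ v * N = Nat.card C := by
      have h1 : θ.ker.index * Nat.card θ.ker = Nat.card C := θ.ker.index_mul_card
      rwa [Subgroup.index_ker, hA, hcard] at h1
    -- `u` with `N u ≡ 1 (mod p^v)`
    have hcop : Nat.Coprime N (p ^ v) := Nat.Coprime.pow_right v ((Nat.Prime.coprime_iff_not_dvd hp.out).mpr hker).symm
    obtain ⟨c₀, hc₀⟩ : ∃ c₀ : C, θ c₀ = ((a : {a : A // h * (a : H) * h⁻¹ = a}) : A) := by
      have hmem : (((a : A)) : H) ∈ θ.range := by rw [hA]; exact (a : A).2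
      obtain ⟨c₀, hc₀⟩ := hmem
      exact ⟨c₀, hc₀⟩
    have hapow : (((a : A) : H)) ^ p ^ v = 1 := by
      have h1 : ((a : A)) ^ p ^ v = 1 := by rw [← hcard]; exact pow_card_eq_one'
      have h2 := congrArg (fun z : A => (z : H)) h1
      simpa using h2
    -- the `p`-primary preimage
    obtain ⟨c, hcθ, hcpow⟩ : ∃ c : C, θ c = ((a : A) : H) ∧ c ^ p ^ v = 1 := by
      rcases Nat.eq_zero_or_pos v with hv0 | hvpos
      · -- `v = 0`: `A` is trivial, take `c = 1`
        refine ⟨1, ?_, by rw [one_pow]⟩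
        rw [map_one]
        have h1 : ((a : A)) ^ p ^ v = 1 := by rw [← hcard]; exact pow_card_eq_one'
        rw [hv0, pow_zero, pow_one] at h1
        have h2 := congrArg (fun z : A => (z : H)) h1
        simpa using h2.symm
      · have h1lt : 1 < p ^ v := Nat.one_lt_pow (by omega) hp.out.one_lt
        obtain ⟨u, -, hu⟩ := Nat.exists_mul_mod_eq_one_of_coprime hcop h1lt
        refine ⟨c₀ ^ (N * u), ?_, ?_⟩
        · rw [map_pow, hc₀]
          have hNu : N * u = p ^ v * (N * u / p ^ v) + 1 := by
            have := Nat.div_add_mod (N * u) (p ^ v); rw [hu] at this; exact this.symm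
          rw [hNu, pow_add, pow_one, pow_mul, hapow, one_pow, one_mul]
        · rw [← pow_mul, mul_comm (N * u), ← mul_assoc, hNC, pow_mul, pow_card_eq_one', one_pow]
    -- `c` is `α`-fixed
    have hαc : α c = c := by
      have hzker : α c * c⁻¹ ∈ θ.ker := by
        rw [MonoidHom.mem_ker, map_mul, map_inv, heq, hcθ]
        have ha2 : h * ((a : A) : H) * h⁻¹ = (a : A) := a.2
        rw [ha2, mul_inv_cancel]
      have hzpow : (α c * c⁻¹) ^ p ^ v = 1 := by
        rw [mul_pow, inv_pow, ← map_pow, hcpow, map_one, one_mul, inv_one]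
      have hord1 : orderOf (α c * c⁻¹) ∣ p ^ v := orderOf_dvd_of_pow_eq_one hzpow
      have hord2 : orderOf (α c * c⁻¹) ∣ N := Subgroup.orderOf_dvd_natCard θ.ker hzker
      have hone : orderOf (α c * c⁻¹) = 1 :=
        Nat.Coprime.eq_one_of_dvd (Nat.Coprime.coprime_dvd_left hord1 hcop.symm) hord2
      rwa [orderOf_eq_one_iff, mul_inv_eq_one] at hone
    -- `c ∈ FixC`, `p`-primary, hence in the (unique, normal) Sylow subgroup `P`
    have hcFix : c ∈ FixC := hαc
    have hcP : (⟨c, hcFix⟩ : FixC) ∈ (P : Subgroup FixC) := by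
      have hz : IsPGroup p (Subgroup.zpowers (⟨c, hcFix⟩ : FixC)) := by
        apply IsPGroup.of_card (n := (Nat.card (Subgroup.zpowers (⟨c, hcFix⟩ : FixC))).factorization p)
        have hord : orderOf (⟨c, hcFix⟩ : FixC) ∣ p ^ v := by
          apply orderOf_dvd_of_pow_eq_one
          exact Subtype.ext (by simpa using hcpow)
        rw [Nat.card_zpowers]
        obtain ⟨k, -, hk⟩ := (Nat.dvd_prime_pow hp.out).mp hord
        rw [hk, Nat.Prime.factorization_pow hp.out, Finsupp.single_eq_same]
      obtain ⟨Q, hQ⟩ := hz.exists_le_sylow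
      haveI : Unique (Sylow p FixC) := Sylow.unique_of_normal P inferInstance
      have hPQ : Q = P := Subsingleton.elim _ _
      rw [← hPQ]
      exact hQ (Subgroup.mem_zpowers _)
    refine ⟨⟨⟨c, hcFix⟩, hcP⟩, ?_⟩
    apply Subtype.ext; apply Subtype.ext
    exact hcθ
  rw [← hP]
  exact (Nat.card_eq_of_bijective f ⟨hf, hsurj⟩).symm


/-- **The Artin map of the `p`-Hilbert class field is equivariant, fixed-point form.**  `T` a number field, Galois over `B`; `H_T` its Hilbert
class field (Galois over `B`), `HqF ⊆ H_T` an intermediate field Galois over `T` and over `B`; `A' = Gal(HqF/T) ≤ Gal(HqF/B)` of order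
`p^{v_p h_T}` (so `HqF` is the `p`-Hilbert class field).  For `g ∈ Gal(HqF/B)` with restriction `σ = g|_T`: the Artin map
`c ↦ (H_T/T, c)|_{HqF}` satisfies `(σc) ↦ g (c ↦) g⁻¹` ([NeukirchANT1999] IV §6, VI (7.1); tree `artinEquiv_mulEquiv_intAut_apply` with the lift
`g̃ = g.liftNormal H_T`), its kernel has order prime to `p`, hence — EXACTLY — **`#{a ∈ A' : g a g⁻¹ = a} = p^{v_p #{c : σc = c}}`**.
[cite: NeukirchANT1999, Ch. IV §6 and Ch. VI §7 Thm. (7.1)] [cite: Cox2013, §8.A Thm. 8.10] -/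
theorem natCard_fixed_eq_pow_padicValNat_card_fixed_classGroup (p : ℕ) [Fact p.Prime] {B : Type*} [Field B]
    (T : Type) [Field T] [NumberField T] [Algebra B T] [Normal B T]
    [Algebra B (hilbertClassField T)] [IsScalarTower B T (hilbertClassField T)] [Normal B (hilbertClassField T)]
    (HqF : IntermediateField T (hilbertClassField T)) [Normal T HqF]
    [IsScalarTower B T HqF] [IsScalarTower B HqF (hilbertClassField T)] [Finite (HqF ≃ₐ[B] HqF)]
    (A' : Subgroup (HqF ≃ₐ[B] HqF))
    (hmemA' : ∀ g : HqF ≃ₐ[B] HqF, g ∈ A' ↔ ∀ x : T, g (algebraMap T HqF x) = algebraMap T HqF x)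
    (hA'card : Nat.card A' = p ^ padicValNat p (Nat.card (ClassGroup (𝓞 T))))
    (g : HqF ≃ₐ[B] HqF) :
    Nat.card {a : A' // g * (a : HqF ≃ₐ[B] HqF) * g⁻¹ = a} =
      p ^ padicValNat p (Nat.card {c : ClassGroup (𝓞 T) //
        ClassGroup.mulEquiv (AmbiguousClass.intAut (g.restrictNormal T)) c = c}) := by
  classical
  -- restriction of scalars `Gal(HqF/T) → Gal(HqF/B)`
  let ρT : (HqF ≃ₐ[T] HqF) →* (HqF ≃ₐ[B] HqF) :=
    { toFun := fun σ => σ.restrictScalars B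
      map_one' := rfl
      map_mul' := fun _ _ => rfl }
  have hρT_apply : ∀ (σ : HqF ≃ₐ[T] HqF) (y : HqF), ρT σ y = σ y := fun _ _ => rfl
  -- the Artin map into `Gal(HqF/B)`
  let θ : ClassGroup (𝓞 T) →* (HqF ≃ₐ[B] HqF) :=
    ρT.comp ((AlgEquiv.restrictNormalHom (F := T) HqF).comp (hilbertClassField.artinEquiv T).toMonoidHom)
  have hθ_apply : ∀ (c : ClassGroup (𝓞 T)) (y : HqF),
      algebraMap HqF (hilbertClassField T) (θ c y) = hilbertClassField.artinEquiv T c (algebraMap HqF (hilbertClassField T) y) := by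
    intro c y
    change algebraMap HqF (hilbertClassField T) (((hilbertClassField.artinEquiv T c).restrictNormal HqF) y) = _
    exact AlgEquiv.restrictNormal_commutes _ HqF y
  -- `range θ = A'`
  have hrange : θ.range = A' := by
    ext a
    constructor
    · rintro ⟨c, rfl⟩
      rw [hmemA']
      intro x
      change (((hilbertClassField.artinEquiv T c).restrictNormal HqF).restrictScalars B) (algebraMap T HqF x) = _
      rw [AlgEquiv.restrictScalars_apply]
      exact ((hilbertClassField.artinEquiv T c).restrictNormal HqF).commutes x
    · intro ha
      let ψ : HqF ≃ₐ[T] HqF := { a with commutes' := fun x => (hmemA' a).mp ha x }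
      obtain ⟨φ, hφ⟩ := AlgEquiv.restrictNormalHom_surjective (F := T) (K₁ := HqF) (hilbertClassField T) ψ
      obtain ⟨c, hc⟩ := (hilbertClassField.artinEquiv T).surjective φ
      refine ⟨c, ?_⟩
      apply AlgEquiv.ext
      intro y
      change (((hilbertClassField.artinEquiv T c).restrictNormal HqF).restrictScalars B) y = a y
      rw [AlgEquiv.restrictScalars_apply, hc]
      have : (AlgEquiv.restrictNormalHom HqF φ) y = ψ y := by rw [hφ]
      exact this
  -- equivariance
  set σ₀ : T ≃ₐ[B] T := g.restrictNormal T with hσ₀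
  set τ : hilbertClassField T ≃ₐ[B] hilbertClassField T := g.liftNormal (hilbertClassField T) with hτ
  have hτg : ∀ z : HqF, τ (algebraMap HqF (hilbertClassField T) z) = algebraMap HqF (hilbertClassField T) (g z) :=
    fun z => AlgEquiv.liftNormal_commutes g (hilbertClassField T) z
  have hτσ : ∀ x : T, τ (algebraMap T (hilbertClassField T) x) = algebraMap T (hilbertClassField T) (σ₀ x) := by
    intro x
    rw [IsScalarTower.algebraMap_apply T HqF (hilbertClassField T) x, hτg,
      IsScalarTower.algebraMap_apply T HqF (hilbertClassField T) (σ₀ x), hσ₀, AlgEquiv.restrictNormal_commutes]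
  have heq : ∀ c, θ (ClassGroup.mulEquiv (AmbiguousClass.intAut σ₀) c) = g * θ c * g⁻¹ := by
    intro c
    apply AlgEquiv.ext
    intro y
    apply (algebraMap HqF (hilbertClassField T)).injective
    rw [hθ_apply, hilbertClassField.artinEquiv_mulEquiv_intAut_apply T τ σ₀ hτσ c, AlgEquiv.mul_apply, AlgEquiv.mul_apply]
    have hsymm : τ.symm (algebraMap HqF (hilbertClassField T) y) = algebraMap HqF (hilbertClassField T) (g⁻¹ y) := by
      rw [AlgEquiv.symm_apply_eq, hτg]
      change _ = algebraMap HqF (hilbertClassField T) (g (g.symm y))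
      rw [AlgEquiv.apply_symm_apply]
    rw [hsymm, ← hθ_apply, hτg]
  -- count
  have := natCard_fixed_eq_pow_padicValNat θ A' hrange hA'card (ClassGroup.mulEquiv (AmbiguousClass.intAut σ₀)) g heq
  exact this


end Fixed

variable {K : Type} [Field K] [NumberField K] {p : ℕ} [hp : Fact p.Prime]

set_option maxHeartbeats 40000000 in
set_option synthInstance.maxHeartbeats 400000 in
/-- **The package with the EXACT ambiguous-class count.** For a `ℤ_p`-extension `κ` with Fukuda index `n₀ ≤ n` and `t ≥ 1` there are: a finite
group `G` (`= Gal(H_p(K_{n+t})/K_n)`), an abelian normal subgroup `A` of index `p^t` and order `p^{e_{n+t}}`, an element `g` with `⟨g⟩ ∩ A = 1`,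
`A⟨g⟩ = G`, and a family `𝓘` of subgroups («inertia groups») with `I ∩ A = 1`, `I = 1 ∨ IA = G`, `⟨g⟩ ∈ 𝓘`, such that for every `j ≤ t` some
subgroup `G_j ⊇ A` of index `p^j` has `[G_j : G_j'·⟨I ∩ G_j⟩] = p^{e_{n+j}}` and `[G_j : G_j'·⟨I ∩ G_j⟩·G_j^p] = p^{r_{n+j}}` (`e` = `ord_p h`,
`r` = `rank_p Cl` of the layers) — VERBATIM the package `exists_layer_package` of k8t-c4 g20 — AND, NEW: a `K`-automorphism `σ` of `K_{n+t}` fixing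
`K_n` pointwise, of which every `K`-automorphism of `K_{n+t}` fixing `K_n` pointwise is a power (`σ = g|_{K_{n+t}}`), with
**`#{a ∈ A : g a g⁻¹ = a} = p ^ v_p #{c ∈ Cl(K_{n+t}) : σ c = c}`** (equivariance of the Artin map and coprimality of its kernel to `p`,
`natCard_fixed_eq_pow_padicValNat_card_fixed_classGroup`; g42's `exists_layer_package_fixed` is the inequality `≥`).
[cite: Fukuda1994, Thm. 1, p. 264 (proof)] [cite: Washington1997, §13.3 Lemmas 13.15 and 13.18, Prop. 13.22]
[cite: NeukirchANT1999, Ch. IV §6 and Ch. VI §7 Thm. (7.1)] [cite: Lang1990, Ch. 13 §4 Lemma 4.1] -/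
theorem exists_layer_package_fixed_eq (κ : ZpExtension K p) {n₀ n : ℕ} (hκ : TotallyRamifiedFrom κ n₀) (hn : n₀ ≤ n) (t : ℕ) (ht : 1 ≤ t) :
    ∃ (G : Type) (_ : Group G) (_ : Finite G) (A : Subgroup G) (_ : A.Normal) (_ : IsMulCommutative A) (g : G)
      (𝓘 : Set (Subgroup G)),
      Subgroup.zpowers g ⊓ A = ⊥ ∧ A ⊔ Subgroup.zpowers g = ⊤ ∧ A.index = p ^ t ∧
      (∀ I ∈ 𝓘, I ⊓ A = ⊥ ∧ (I = ⊥ ∨ I ⊔ A = ⊤)) ∧ Subgroup.zpowers g ∈ 𝓘 ∧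
      Nat.card A = p ^ classNumberPExp κ (n + t) ∧
      (∃ σ : (κ.layer (n + t)) ≃ₐ[K] (κ.layer (n + t)),
        (∀ y : κ.layer (n + t), ((y : κ.layer (n + t)) : AlgebraicClosure K) ∈ κ.layer n → σ y = y) ∧
        (∀ τ : (κ.layer (n + t)) ≃ₐ[K] (κ.layer (n + t)),
          (∀ y : κ.layer (n + t), ((y : κ.layer (n + t)) : AlgebraicClosure K) ∈ κ.layer n → τ y = y) →
            τ ∈ Subgroup.zpowers σ) ∧
        Nat.card {a : A // g * (a : G) * g⁻¹ = a} =
          p ^ padicValNat p (Nat.card {c : ClassGroup (𝓞 (κ.layer (n + t))) //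
            ClassGroup.mulEquiv (AmbiguousClass.intAut σ) c = c})) ∧
      ∀ j, j ≤ t → ∃ Gj : Subgroup G, A ≤ Gj ∧ Gj.index = p ^ j ∧
        (⁅Gj, Gj⁆ ⊔ ⨆ I ∈ 𝓘, I ⊓ Gj).relIndex Gj = p ^ classNumberPExp κ (n + j) ∧
        ((⁅Gj, Gj⁆ ⊔ ⨆ I ∈ 𝓘, I ⊓ Gj) ⊔ Subgroup.closure ((fun x : G => x ^ p) '' (Gj : Set G))).relIndex Gj =
          p ^ classGroupPRank κ (n + j) := by
  classical
  -- ### the top layer `T = K_{n+t}` as a type; `B = K_n` as an intermediate field of `T/K`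
  haveI : FiniteDimensional K (κ.layer n) := κ.finiteDimensional_layer_holds n
  haveI : FiniteDimensional K (κ.layer (n + t)) := κ.finiteDimensional_layer_holds (n + t)
  haveI : IsGalois K (κ.layer n) := κ.isGalois_layer_holds n
  haveI : IsGalois K (κ.layer (n + t)) := κ.isGalois_layer_holds (n + t)
  haveI : NumberField (κ.layer n) := NumberField.of_module_finite K _
  haveI : NumberField (κ.layer (n + t)) := NumberField.of_module_finite K _
  have hBF : κ.layer n ≤ κ.layer (n + t) := κ.layer_mono (Nat.le_add_right n t)
  obtain ⟨Bi, hBi⟩ : ∃ Bi : IntermediateField K (κ.layer (n + t)), Bi = IntermediateField.restrict hBF := ⟨_, rfl⟩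
  let eB : (κ.layer n) ≃ₐ[K] Bi := (IntermediateField.restrict_algEquiv hBF).trans (IntermediateField.equivOfEq hBi.symm)
  haveI : FiniteDimensional K Bi := LinearEquiv.finiteDimensional eB.toLinearEquiv
  haveI : IsGalois K Bi := IsGalois.of_algEquiv eB
  haveI : NumberField Bi := NumberField.of_module_finite K _
  haveI : IsGalois Bi (κ.layer (n + t)) := IsGalois.tower_top_of_isGalois K Bi (κ.layer (n + t))
  have hp0 : 0 < p := hp.out.pos
  have hdegKB : Module.finrank K Bi = p ^ n := by rw [← eB.toLinearEquiv.finrank_eq, κ.finrank_layer_holds n]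
  have hdegBF : Module.finrank Bi (κ.layer (n + t)) = p ^ t := by
    have h := Module.finrank_mul_finrank K Bi (κ.layer (n + t))
    rw [hdegKB, κ.finrank_layer_holds (n + t), pow_add] at h
    exact Nat.eq_of_mul_eq_mul_left (pow_pos hp0 n) h
  -- `Gal(T/B)` is cyclic
  haveI hcycF : IsCyclic ((κ.layer (n + t)) ≃ₐ[Bi] (κ.layer (n + t))) := by
    obtain ⟨ψ, -, hker, -⟩ := κ.exists_cyclicCharacter_layer (n + t)
    haveI : IsCyclic ((κ.layer (n + t)) ≃ₐ[K] (κ.layer (n + t))) := isCyclic_of_cyclicLayer ψ (κ.layer (n + t)) hker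
    let j : ((κ.layer (n + t)) ≃ₐ[Bi] (κ.layer (n + t))) →* ((κ.layer (n + t)) ≃ₐ[K] (κ.layer (n + t))) :=
      { toFun := fun σ => σ.restrictScalars K
        map_one' := rfl
        map_mul' := fun _ _ => rfl }
    have hj : Function.Injective j := fun σ τ h => AlgEquiv.restrictScalars_injective K h
    exact isCyclic_of_surjective (MonoidHom.ofInjective hj).symm.toMonoidHom (MonoidHom.ofInjective hj).symm.surjective
  -- ### the Hilbert class field `H_T`, Galois over `Bi`
  haveI : IsGalois Bi (hilbertClassField (κ.layer (n + t))) := hilbertClassField.isGalois_of_isGalois (κ.layer (n + t))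
  haveI : FiniteDimensional Bi (hilbertClassField (κ.layer (n + t))) := Module.Finite.trans (κ.layer (n + t)) (hilbertClassField (κ.layer (n + t)))
  haveI : IsUnramifiedAtInfinitePlaces K (κ.layer (n + t)) := κ.isUnramifiedAtInfinitePlaces_layer (n + t)
  haveI : IsUnramifiedAtInfinitePlaces Bi (κ.layer (n + t)) :=
    IsUnramifiedAtInfinitePlaces.top (k := K) (K := Bi) (F := (κ.layer (n + t)))
  haveI : IsUnramifiedAtInfinitePlaces Bi (hilbertClassField (κ.layer (n + t))) := IsUnramifiedAtInfinitePlaces.trans Bi (κ.layer (n + t)) (hilbertClassField (κ.layer (n + t)))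
  -- `A = Gal(H_T/T) = ker (Gal(H_T/B) → Gal(T/B))`
  obtain ⟨πF, hπF⟩ : ∃ πF : ((hilbertClassField (κ.layer (n + t))) ≃ₐ[Bi] (hilbertClassField (κ.layer (n + t)))) →* ((κ.layer (n + t)) ≃ₐ[Bi] (κ.layer (n + t))), πF = AlgEquiv.restrictNormalHom (κ.layer (n + t)) :=
    ⟨_, rfl⟩
  have hπF_surj : Function.Surjective πF := by
    rw [hπF]; exact AlgEquiv.restrictNormalHom_surjective (hilbertClassField (κ.layer (n + t)))
  have hπF_apply : ∀ g : (hilbertClassField (κ.layer (n + t))) ≃ₐ[Bi] (hilbertClassField (κ.layer (n + t))), πF g = g.restrictNormal (κ.layer (n + t)) := fun g => by rw [hπF]; rfl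
  obtain ⟨A, hA⟩ : ∃ A : Subgroup ((hilbertClassField (κ.layer (n + t))) ≃ₐ[Bi] (hilbertClassField (κ.layer (n + t)))), A = πF.ker := ⟨_, rfl⟩
  haveI hAn : A.Normal := by rw [hA]; infer_instance
  have hmemA : ∀ g : (hilbertClassField (κ.layer (n + t))) ≃ₐ[Bi] (hilbertClassField (κ.layer (n + t))), g ∈ A ↔ ∀ x : (κ.layer (n + t)), g (algebraMap (κ.layer (n + t)) (hilbertClassField (κ.layer (n + t))) x) = algebraMap (κ.layer (n + t)) (hilbertClassField (κ.layer (n + t))) x := by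
    intro g
    rw [hA, MonoidHom.mem_ker]
    constructor
    · intro h x
      have h1 := AlgEquiv.restrictNormal_commutes g (κ.layer (n + t)) x
      rw [← hπF_apply, h, AlgEquiv.one_apply] at h1
      exact h1.symm
    · intro h
      apply AlgEquiv.ext
      intro x
      apply (algebraMap (κ.layer (n + t)) (hilbertClassField (κ.layer (n + t)))).injective
      rw [AlgEquiv.one_apply, hπF_apply, AlgEquiv.restrictNormal_commutes]
      exact h x
  have toF : ∀ g ∈ A, ∃ g' : (hilbertClassField (κ.layer (n + t))) ≃ₐ[(κ.layer (n + t))] (hilbertClassField (κ.layer (n + t))), ∀ x, g' x = g x := fun g hg =>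
    ⟨{ g with commutes' := fun x => (hmemA g).mp hg x }, fun _ => rfl⟩
  have hAcomm : ∀ a ∈ A, ∀ b ∈ A, a * b = b * a := by
    intro a ha b hb
    obtain ⟨a', ha'⟩ := toF a ha
    obtain ⟨b', hb'⟩ := toF b hb
    have hc : a' * b' = b' * a' := (IsAbelianGalois.toIsMulCommutative (K := ↥(κ.layer (n + t))) (L := (hilbertClassField (κ.layer (n + t))))).is_comm.comm a' b'
    apply AlgEquiv.ext
    intro x
    have h := congrArg (fun f : (hilbertClassField (κ.layer (n + t))) ≃ₐ[(κ.layer (n + t))] (hilbertClassField (κ.layer (n + t))) => f x) hc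
    simp only [AlgEquiv.mul_apply] at h ⊢
    rw [← ha', ← hb', h, hb', ha']
  haveI : IsMulCommutative A := ⟨⟨fun a b => Subtype.ext (hAcomm a a.2 b b.2)⟩⟩
  have hAindex : A.index = p ^ t := by
    rw [hA, Subgroup.index_ker, MonoidHom.range_eq_top.mpr hπF_surj, Subgroup.card_top, IsGalois.card_aut_eq_finrank, hdegBF]
  have hAcard : Nat.card A = classNumber (κ.layer (n + t)) := by
    have h1 : A.index * Nat.card A = Nat.card ((hilbertClassField (κ.layer (n + t))) ≃ₐ[Bi] (hilbertClassField (κ.layer (n + t)))) := A.index_mul_card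
    rw [hAindex, IsGalois.card_aut_eq_finrank, ← Module.finrank_mul_finrank Bi (κ.layer (n + t)) (hilbertClassField (κ.layer (n + t))), hdegBF,
      hilbertClassField.finrank_eq_classNumber] at h1
    exact Nat.eq_of_mul_eq_mul_left (pow_pos hp0 t) h1
  -- ### the prime-to-`p` part `A₀` of `A` and the `p`-Hilbert class field `Hp = H_T^{A₀}`
  obtain ⟨A₀', hA₀'mem, hA₀'index⟩ := exists_subgroup_index_eq_pow_padicValNat_card A p
  obtain ⟨A₀, hA₀⟩ : ∃ A₀ : Subgroup ((hilbertClassField (κ.layer (n + t))) ≃ₐ[Bi] (hilbertClassField (κ.layer (n + t)))), A₀ = A₀'.map A.subtype := ⟨_, rfl⟩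
  have hA₀A : A₀ ≤ A := by
    rw [hA₀]; rintro _ ⟨g, -, rfl⟩; exact g.2
  have hmemA₀ : ∀ g, g ∈ A₀ ↔ g ∈ A ∧ ¬ p ∣ orderOf g := by
    intro g
    rw [hA₀, Subgroup.mem_map]
    constructor
    · rintro ⟨g', hg', rfl⟩
      refine ⟨g'.2, ?_⟩
      rw [Subgroup.coe_subtype, Subgroup.orderOf_coe]
      exact (hA₀'mem g').mp hg'
    · rintro ⟨hgA, hg⟩
      refine ⟨⟨g, hgA⟩, (hA₀'mem _).mpr ?_, rfl⟩
      rwa [Subgroup.orderOf_mk]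
  haveI hA₀n : A₀.Normal := ⟨fun m hm g => by
    rw [hmemA₀] at hm ⊢
    refine ⟨hAn.conj_mem m hm.1 g, ?_⟩
    have : orderOf (g * m * g⁻¹) = orderOf m := by
      rw [show g * m * g⁻¹ = MulAut.conj g m from rfl]
      exact orderOf_injective (MulAut.conj g).toMonoidHom (MulAut.conj g).injective m
    rw [this]; exact hm.2⟩
  have hA₀relindex : A₀.relIndex A = p ^ padicValNat p (classNumber (κ.layer (n + t))) := by
    rw [← hAcard, ← hA₀'index, Subgroup.relIndex, hA₀]
    congr 1
    ext g
    simp only [Subgroup.mem_subgroupOf, Subgroup.mem_map, Subgroup.coe_subtype]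
    constructor
    · rintro ⟨g', hg', hgg'⟩
      have : g' = g := Subtype.ext hgg'
      rwa [← this]
    · intro hg; exact ⟨g, hg, rfl⟩
  obtain ⟨Hp, hHp⟩ : ∃ Hp : IntermediateField Bi (hilbertClassField (κ.layer (n + t))), Hp = IntermediateField.fixedField A₀ := ⟨_, rfl⟩
  haveI hHpGal : IsGalois Bi Hp := by rw [hHp]; exact IsGalois.of_fixedField_normal_subgroup A₀
  have hFmem : ∀ x : (κ.layer (n + t)), algebraMap (κ.layer (n + t)) (hilbertClassField (κ.layer (n + t))) x ∈ Hp := by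
    intro x
    rw [hHp, IntermediateField.mem_fixedField_iff]
    intro g hg
    exact (hmemA g).mp (hA₀A hg) x
  -- `Hp` as an intermediate field OVER `T` (same carrier): `HqF`
  obtain ⟨HqF, hmemHqF⟩ : ∃ HqF : IntermediateField (κ.layer (n + t)) (hilbertClassField (κ.layer (n + t))), ∀ x : (hilbertClassField (κ.layer (n + t))), x ∈ HqF ↔ x ∈ Hp :=
    ⟨Hp.toSubfield.toIntermediateField hFmem, fun _ => Iff.rfl⟩
  let eHq : Hp ≃ₐ[Bi] HqF :=
    { toFun := fun x => ⟨(x : (hilbertClassField (κ.layer (n + t)))), (hmemHqF _).mpr x.2⟩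
      invFun := fun x => ⟨(x : (hilbertClassField (κ.layer (n + t)))), (hmemHqF _).mp x.2⟩
      left_inv := fun _ => rfl
      right_inv := fun _ => rfl
      map_mul' := fun _ _ => rfl
      map_add' := fun _ _ => rfl
      commutes' := fun _ => rfl }
  haveI : IsGalois Bi HqF := IsGalois.of_algEquiv eHq
  haveI : FiniteDimensional Bi HqF := LinearEquiv.finiteDimensional eHq.toLinearEquiv
  haveI : NumberField HqF := NumberField.of_module_finite (κ.layer (n + t)) HqF
  haveI : IsScalarTower Bi HqF (hilbertClassField (κ.layer (n + t))) := IsScalarTower.of_algebraMap_eq fun _ => rfl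
  haveI : IsGalois (κ.layer (n + t)) HqF := IsGalois.tower_top_of_isGalois Bi (κ.layer (n + t)) HqF
  haveI : IsUnramifiedAtInfinitePlaces Bi HqF := IsUnramifiedAtInfinitePlaces.bot (k := Bi) (K := HqF) (F := (hilbertClassField (κ.layer (n + t))))
  -- ### `Gal(H_T/T) ↪ Gal(H_T/B)` with image `A`; every `p`-power sub-extension of `H_T/T` lies in `HqF`
  let ρE : ((hilbertClassField (κ.layer (n + t))) ≃ₐ[(κ.layer (n + t))] (hilbertClassField (κ.layer (n + t)))) →* ((hilbertClassField (κ.layer (n + t))) ≃ₐ[Bi] (hilbertClassField (κ.layer (n + t)))) :=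
    { toFun := fun σ => σ.restrictScalars Bi
      map_one' := rfl
      map_mul' := fun _ _ => rfl }
  have hρE_inj : Function.Injective ρE := fun σ τ h => AlgEquiv.restrictScalars_injective Bi h
  have hρE_surj : ∀ g ∈ A, ∃ σ, ρE σ = g := fun g hg =>
    ⟨{ g with commutes' := fun x => (hmemA g).mp hg x }, AlgEquiv.ext fun _ => rfl⟩
  have hmax : ∀ L : IntermediateField (κ.layer (n + t)) (hilbertClassField (κ.layer (n + t))), (∃ k, Module.finrank (κ.layer (n + t)) L = p ^ k) → L ≤ HqF := by
    rintro L ⟨k, hk⟩ x hx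
    rw [hmemHqF, hHp, IntermediateField.mem_fixedField_iff]
    intro g hg
    obtain ⟨σ, rfl⟩ := hρE_surj g (hA₀A hg)
    have hσord : ¬ p ∣ orderOf σ := by
      have h1 := ((hmemA₀ _).mp hg).2
      rwa [orderOf_injective ρE hρE_inj σ] at h1
    set τ := AlgEquiv.restrictNormalHom L σ with hτ
    have hτ1 : τ = 1 := by
      have h1 : orderOf τ ∣ p ^ k := by
        rw [← hk, ← IsGalois.card_aut_eq_finrank]
        exact orderOf_dvd_natCard τ
      obtain ⟨j, -, hj⟩ := (Nat.dvd_prime_pow hp.out).mp h1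
      have h2 : orderOf τ ∣ orderOf σ := orderOf_map_dvd _ σ
      rcases j with _ | j
      · rwa [pow_zero, orderOf_eq_one_iff] at hj
      · exact absurd ((Dvd.intro_left _ (pow_succ p j).symm).trans (hj ▸ h2)) hσord
    have h3 := AlgEquiv.restrictNormal_commutes σ L ⟨x, hx⟩
    rw [show σ.restrictNormal L = τ from rfl, hτ1, AlgEquiv.one_apply] at h3
    exact h3.symm
  -- ### the Galois group `Gp = Gal(H_p/B)` (`H_p = HqF`), `A' = Gal(H_p/T)`
  haveI : IsScalarTower Bi (κ.layer (n + t)) HqF := IsScalarTower.of_algebraMap_eq fun _ => rfl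
  obtain ⟨res, hresdef⟩ : ∃ res : (HqF ≃ₐ[Bi] HqF) →* ((κ.layer (n + t)) ≃ₐ[Bi] (κ.layer (n + t))), res = AlgEquiv.restrictNormalHom (κ.layer (n + t)) :=
    ⟨_, rfl⟩
  have hres_surj : Function.Surjective res := by
    rw [hresdef]; exact AlgEquiv.restrictNormalHom_surjective HqF
  have hres_apply : ∀ g : HqF ≃ₐ[Bi] HqF, res g = g.restrictNormal (κ.layer (n + t)) := fun g => by rw [hresdef]; rfl
  obtain ⟨A', hA'⟩ : ∃ A' : Subgroup (HqF ≃ₐ[Bi] HqF), A' = res.ker := ⟨_, rfl⟩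
  haveI hA'n : A'.Normal := by rw [hA']; infer_instance
  have hA'index : A'.index = p ^ t := by
    rw [hA', Subgroup.index_ker, MonoidHom.range_eq_top.mpr hres_surj, Subgroup.card_top, IsGalois.card_aut_eq_finrank, hdegBF]
  have hcycQ : IsCyclic ((HqF ≃ₐ[Bi] HqF) ⧸ A') :=
    isCyclic_of_surjective _ (((QuotientGroup.quotientKerEquivOfSurjective res hres_surj).symm.trans
      (QuotientGroup.quotientMulEquivOfEq hA').symm).surjective)
  have hmemA' : ∀ g : HqF ≃ₐ[Bi] HqF, g ∈ A' ↔ ∀ x : (κ.layer (n + t)), g (algebraMap (κ.layer (n + t)) HqF x) = algebraMap (κ.layer (n + t)) HqF x := by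
    intro g
    rw [hA', MonoidHom.mem_ker]
    constructor
    · intro h x
      have h1 := AlgEquiv.restrictNormal_commutes g (κ.layer (n + t)) x
      rw [← hres_apply, h, AlgEquiv.one_apply] at h1
      exact h1.symm
    · intro h
      apply AlgEquiv.ext
      intro x
      apply (algebraMap (κ.layer (n + t)) HqF).injective
      rw [AlgEquiv.one_apply, hres_apply, AlgEquiv.restrictNormal_commutes]
      exact h x
  let ρT : (HqF ≃ₐ[(κ.layer (n + t))] HqF) →* (HqF ≃ₐ[Bi] HqF) :=
    { toFun := fun σ => σ.restrictScalars Bi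
      map_one' := rfl
      map_mul' := fun _ _ => rfl }
  have hρT_inj : Function.Injective ρT := fun σ τ h => AlgEquiv.restrictScalars_injective Bi h
  have hρT_range : ρT.range = A' := by
    ext g
    constructor
    · rintro ⟨σ, rfl⟩
      exact (hmemA' _).mpr fun x => σ.commutes x
    · intro hg
      exact ⟨{ g with commutes' := fun x => (hmemA' g).mp hg x }, AlgEquiv.ext fun _ => rfl⟩
  have hA'comm : ∀ a ∈ A', ∀ b ∈ A', a * b = b * a := by
    intro a ha b hb
    rw [← hρT_range] at ha hb
    obtain ⟨σ, rfl⟩ := ha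
    obtain ⟨τ, rfl⟩ := hb
    rw [← map_mul, ← map_mul, (IsAbelianGalois.toIsMulCommutative (K := ↥(κ.layer (n + t))) (L := ↥HqF)).is_comm.comm σ τ]
  haveI : IsMulCommutative A' := ⟨⟨fun a b => Subtype.ext (hA'comm a a.2 b b.2)⟩⟩
  -- `#Gp = p^t · p^{e_{n+t}}`, `#A' = p^{e_{n+t}}`
  have hA₀card : p ^ padicValNat p (classNumber (κ.layer (n + t))) * Nat.card A₀ = classNumber (κ.layer (n + t)) := by
    rw [← hA₀relindex, ← hAcard, Subgroup.relIndex,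
      ← Nat.card_congr (Subgroup.subgroupOfEquivOfLe hA₀A).toEquiv]
    exact Subgroup.index_mul_card _
  have hA₀pos : 0 < Nat.card A₀ := Nat.card_pos
  haveI : Module.Free Bi Hp := Module.Free.of_divisionRing Bi Hp
  haveI : Module.Free Hp (hilbertClassField (κ.layer (n + t))) := Module.Free.of_divisionRing Hp _
  haveI : Module.Free Bi (hilbertClassField (κ.layer (n + t))) := Module.Free.of_divisionRing Bi _
  haveI : Module.Free (κ.layer (n + t)) (hilbertClassField (κ.layer (n + t))) := Module.Free.of_divisionRing _ _
  haveI : Module.Free Bi (κ.layer (n + t)) := Module.Free.of_divisionRing Bi _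
  have hdegHp : Module.finrank Bi HqF = p ^ t * p ^ padicValNat p (classNumber (κ.layer (n + t))) := by
    rw [← eHq.toLinearEquiv.finrank_eq]
    have h1 := Module.finrank_mul_finrank Bi Hp (hilbertClassField (κ.layer (n + t)))
    rw [hHp, IntermediateField.finrank_fixedField_eq_card A₀, ← hHp,
      ← Module.finrank_mul_finrank Bi (κ.layer (n + t)) (hilbertClassField (κ.layer (n + t))), hdegBF, hilbertClassField.finrank_eq_classNumber,
      ← hA₀card, ← mul_assoc] at h1
    exact Nat.eq_of_mul_eq_mul_right hA₀pos h1
  have hGpcard : Nat.card (HqF ≃ₐ[Bi] HqF) = p ^ t * p ^ padicValNat p (classNumber (κ.layer (n + t))) := by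
    rw [IsGalois.card_aut_eq_finrank, hdegHp]
  have hA'card : Nat.card A' = p ^ padicValNat p (classNumber (κ.layer (n + t))) := by
    have h1 := A'.index_mul_card
    rw [hA'index, hGpcard] at h1
    exact Nat.eq_of_mul_eq_mul_left (pow_pos hp0 t) h1
  have hApg : IsPGroup p A' := IsPGroup.of_card hA'card
  -- ### inertia groups: `I(𝔔) ≤ Gp` meets `A'` trivially and is trivial or a complement of `A'`
  have heT : ∀ (Q : Ideal (𝓞 HqF)) [Q.IsMaximal], Q.ramificationIdx (𝓞 (κ.layer (n + t))) = 1 := by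
    intro Q _
    obtain ⟨P, hPmax, hPQ⟩ := Ideal.exists_maximal_ideal_liesOver_of_isIntegral (S := 𝓞 (hilbertClassField (κ.layer (n + t)))) Q
    haveI := hPmax
    haveI := hPQ
    haveI := hilbertClassField.isUnramifiedAt (κ.layer (n + t)) P
    have h1 : P.ramificationIdx (𝓞 (κ.layer (n + t))) = 1 := Ideal.ramificationIdx_eq_one P (𝓞 (κ.layer (n + t)))
    rw [Ideal.ramificationIdx_tower Q P] at h1
    exact Nat.eq_one_of_mul_eq_one_right h1
  have hcardI : ∀ (Q : Ideal (𝓞 HqF)) [Q.IsMaximal],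
      Nat.card (Q.inertia (HqF ≃ₐ[Bi] HqF)) = Nat.card ((Q.under (𝓞 (κ.layer (n + t)))).inertia ((κ.layer (n + t)) ≃ₐ[Bi] (κ.layer (n + t)))) := by
    intro Q _
    haveI : (Q.under (𝓞 (κ.layer (n + t)))).IsMaximal := Ideal.IsMaximal.under (𝓞 (κ.layer (n + t))) Q
    rw [card_inertia_eq_ramificationIdx HqF (HqF ≃ₐ[Bi] HqF) Bi Q,
      card_inertia_eq_ramificationIdx (κ.layer (n + t)) ((κ.layer (n + t)) ≃ₐ[Bi] (κ.layer (n + t))) Bi (Q.under (𝓞 (κ.layer (n + t)))),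
      Ideal.ramificationIdx_tower (Q.under (𝓞 (κ.layer (n + t)))) Q, heT Q, mul_one]
  have htop_of : ∀ (q : Ideal (𝓞 (κ.layer (n + t)))) [q.IsMaximal],
      (∀ g : (κ.layer (n + t)) ≃ₐ[K] (κ.layer (n + t)), (∀ x : (κ.layer (n + t)), (x : AlgebraicClosure K) ∈ κ.layer n → g x = x) →
        g ∈ q.inertia ((κ.layer (n + t)) ≃ₐ[K] (κ.layer (n + t)))) → q.inertia ((κ.layer (n + t)) ≃ₐ[Bi] (κ.layer (n + t))) = ⊤ := by
    intro q _ h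
    rw [eq_top_iff]
    intro σ _
    have h1 : σ.restrictScalars K ∈ q.inertia ((κ.layer (n + t)) ≃ₐ[K] (κ.layer (n + t))) := by
      apply h
      intro x hx
      have hxB : x ∈ Bi := by rw [hBi, IntermediateField.mem_restrict]; exact hx
      exact σ.commutes ⟨x, hxB⟩
    exact fun y => h1 y
  have hdich : ∀ (q : Ideal (𝓞 (κ.layer (n + t)))) [q.IsMaximal],
      q.inertia ((κ.layer (n + t)) ≃ₐ[Bi] (κ.layer (n + t))) = ⊥ ∨ q.inertia ((κ.layer (n + t)) ≃ₐ[Bi] (κ.layer (n + t))) = ⊤ := by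
    intro q _
    rcases κ.inertia_layer_eq_bot_or_forall_mem hκ hn (Nat.le_add_right n t) q with h1 | h2
    · left
      rw [eq_bot_iff]
      intro σ hσ
      have h3 : σ.restrictScalars K ∈ q.inertia ((κ.layer (n + t)) ≃ₐ[K] (κ.layer (n + t))) := fun y => hσ y
      rw [h1, Subgroup.mem_bot] at h3
      rw [Subgroup.mem_bot]
      apply AlgEquiv.restrictScalars_injective K
      rw [h3]
      rfl
    · exact Or.inr (htop_of q h2)
  have hinf : ∀ (Q : Ideal (𝓞 HqF)) [Q.IsMaximal], Q.inertia (HqF ≃ₐ[Bi] HqF) ⊓ A' = ⊥ := by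
    intro Q _
    have h1 : (Q.inertia (HqF ≃ₐ[(κ.layer (n + t))] HqF)).map ρT = Q.inertia (HqF ≃ₐ[Bi] HqF) ⊓ A' := by
      ext g
      constructor
      · rintro ⟨σ, hσ, rfl⟩
        exact ⟨fun y => hσ y, hρT_range ▸ ⟨σ, rfl⟩⟩
      · rintro ⟨hgI, hgA⟩
        rw [← hρT_range] at hgA
        obtain ⟨σ, rfl⟩ := hgA
        exact ⟨σ, fun y => hgI y, rfl⟩
    rw [← h1, ← Subgroup.card_eq_one, Subgroup.card_map_of_injective hρT_inj,
      card_inertia_eq_ramificationIdx HqF (HqF ≃ₐ[(κ.layer (n + t))] HqF) (κ.layer (n + t)) Q, heT Q]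
  have hsup : ∀ (Q : Ideal (𝓞 HqF)) [Q.IsMaximal], Nat.card (Q.inertia (HqF ≃ₐ[Bi] HqF)) = p ^ t →
      Q.inertia (HqF ≃ₐ[Bi] HqF) ⊔ A' = ⊤ := by
    intro Q _ hc
    have h1 : A'.relIndex (Q.inertia (HqF ≃ₐ[Bi] HqF) ⊔ A') = p ^ t := by
      rw [Subgroup.relIndex_sup_right, Subgroup.relIndex,
        Subgroup.subgroupOf_eq_bot.mpr (disjoint_iff.mpr ((inf_comm _ _).trans (hinf Q))), Subgroup.index_bot, hc]
    have h2 := Subgroup.relIndex_mul_index (le_sup_right : A' ≤ Q.inertia (HqF ≃ₐ[Bi] HqF) ⊔ A')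
    rw [h1, hA'index] at h2
    exact Subgroup.index_eq_one.mp (Nat.eq_of_mul_eq_mul_left (pow_pos hp0 t) (h2.trans (mul_one _).symm))
  have hcases : ∀ (Q : Ideal (𝓞 HqF)) [Q.IsMaximal],
      Q.inertia (HqF ≃ₐ[Bi] HqF) = ⊥ ∨ Q.inertia (HqF ≃ₐ[Bi] HqF) ⊔ A' = ⊤ := by
    intro Q _
    haveI : (Q.under (𝓞 (κ.layer (n + t)))).IsMaximal := Ideal.IsMaximal.under (𝓞 (κ.layer (n + t))) Q
    rcases hdich (Q.under (𝓞 (κ.layer (n + t)))) with h1 | h2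
    · left
      rw [← Subgroup.card_eq_one, hcardI Q, h1, Subgroup.card_bot]
    · right
      apply hsup Q
      rw [hcardI Q, h2, Subgroup.card_top, IsGalois.card_aut_eq_finrank, hdegBF]
  have hexists : ∃ (Q : Ideal (𝓞 HqF)) (_ : Q.IsMaximal), Q.inertia (HqF ≃ₐ[Bi] HqF) ⊔ A' = ⊤ := by
    obtain ⟨q, hqmax, hq⟩ := κ.exists_isMaximal_forall_mem_inertia hκ hn (Nat.le_add_right n t) (by omega)
    haveI := hqmax
    obtain ⟨Q, hQmax, hQq⟩ := Ideal.exists_maximal_ideal_liesOver_of_isIntegral (S := 𝓞 HqF) q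
    haveI := hQmax
    refine ⟨Q, hQmax, hsup Q ?_⟩
    rw [hcardI Q, ← hQq.over, htop_of q hq, Subgroup.card_top, IsGalois.card_aut_eq_finrank, hdegBF]
  -- ### the family `𝓘` of inertia groups, and a generator `g` of a totally ramified one
  obtain ⟨𝓘, h𝓘def⟩ : ∃ 𝓘 : Set (Subgroup (HqF ≃ₐ[Bi] HqF)),
      𝓘 = Set.range (fun Q : MaximalSpectrum (𝓞 HqF) => Q.asIdeal.inertia (HqF ≃ₐ[Bi] HqF)) := ⟨_, rfl⟩
  have h𝓘 : ∀ I ∈ 𝓘, I ⊓ A' = ⊥ ∧ (I = ⊥ ∨ I ⊔ A' = ⊤) := by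
    intro I hI
    rw [h𝓘def] at hI
    obtain ⟨Q, rfl⟩ := hI
    haveI := Q.isMaximal
    exact ⟨hinf Q.asIdeal, hcases Q.asIdeal⟩
  obtain ⟨g, hgA, hgen, hg𝓘⟩ : ∃ g : HqF ≃ₐ[Bi] HqF, Subgroup.zpowers g ⊓ A' = ⊥ ∧ A' ⊔ Subgroup.zpowers g = ⊤ ∧ Subgroup.zpowers g ∈ 𝓘 := by
    obtain ⟨Q, hQ, hQsup⟩ := hexists
    haveI := hQ
    have hQinf := hinf Q
    set I₁ := Q.inertia (HqF ≃ₐ[Bi] HqF) with hI₁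
    -- `I₁` embeds into the cyclic group `Gp/A'`, hence is cyclic
    let f : I₁ →* (HqF ≃ₐ[Bi] HqF) ⧸ A' := (QuotientGroup.mk' A').comp I₁.subtype
    have hf : Function.Injective f := by
      intro x y hxy
      have h1 : ((x : HqF ≃ₐ[Bi] HqF))⁻¹ * y ∈ A' := by
        rw [← QuotientGroup.eq]; exact hxy
      have h2 : ((x : HqF ≃ₐ[Bi] HqF))⁻¹ * y ∈ I₁ ⊓ A' := ⟨I₁.mul_mem (I₁.inv_mem x.2) y.2, h1⟩
      rw [hQinf, Subgroup.mem_bot, inv_mul_eq_one] at h2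
      exact Subtype.ext h2
    haveI : IsCyclic I₁ :=
      isCyclic_of_surjective (MonoidHom.ofInjective hf).symm.toMonoidHom (MonoidHom.ofInjective hf).symm.surjective
    obtain ⟨g₀, hg₀⟩ := IsCyclic.exists_generator (α := I₁)
    have hzp : Subgroup.zpowers (g₀ : HqF ≃ₐ[Bi] HqF) = I₁ := by
      apply le_antisymm
      · exact (Subgroup.zpowers_le).mpr g₀.2
      · intro x hx
        obtain ⟨k, hk⟩ := Subgroup.mem_zpowers_iff.mp (hg₀ ⟨x, hx⟩)
        exact Subgroup.mem_zpowers_iff.mpr ⟨k, by rw [← Subgroup.coe_zpow, hk]⟩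
    refine ⟨g₀, by rw [hzp]; exact hQinf, by rw [hzp, sup_comm]; exact hQsup, ?_⟩
    rw [hzp, h𝓘def]
    exact ⟨⟨Q, hQ⟩, rfl⟩
  -- ### NEW: `σ = g|_T` as a `K`-automorphism of `T`, generating `Gal(T/B)`, and the equivariant fixed-point count
  haveI : IsScalarTower Bi (κ.layer (n + t)) (hilbertClassField (κ.layer (n + t))) :=
    IsScalarTower.of_algebraMap_eq fun x => Subtype.ext (IsScalarTower.algebraMap_apply Bi (κ.layer (n + t)) _ x)
  obtain ⟨σ, hσdef⟩ : ∃ σ : (κ.layer (n + t)) ≃ₐ[K] (κ.layer (n + t)),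
      σ = (g.restrictNormal (κ.layer (n + t))).restrictScalars K := ⟨_, rfl⟩
  have hσfix : ∀ y : κ.layer (n + t), ((y : κ.layer (n + t)) : AlgebraicClosure K) ∈ κ.layer n → σ y = y := by
    intro y hy
    have hyB : y ∈ Bi := by rw [hBi, IntermediateField.mem_restrict]; exact hy
    rw [hσdef, AlgEquiv.restrictScalars_apply]
    exact (g.restrictNormal (κ.layer (n + t))).commutes ⟨y, hyB⟩
  have hσgen : ∀ τ : (κ.layer (n + t)) ≃ₐ[K] (κ.layer (n + t)),
      (∀ y : κ.layer (n + t), ((y : κ.layer (n + t)) : AlgebraicClosure K) ∈ κ.layer n → τ y = y) →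
        τ ∈ Subgroup.zpowers σ := by
    intro τ hτ
    -- `τ` is `Bi`-linear
    have hBmem : ∀ y : κ.layer (n + t), y ∈ Bi → ((y : κ.layer (n + t)) : AlgebraicClosure K) ∈ κ.layer n := by
      intro y hy
      rw [hBi, IntermediateField.mem_restrict] at hy
      exact hy
    let τ' : (κ.layer (n + t)) ≃ₐ[Bi] (κ.layer (n + t)) :=
      { τ with
        commutes' := fun b => hτ (b : κ.layer (n + t)) (hBmem _ b.2) }
    -- `τ' = res x` with `x = a · g^k`, `a ∈ A' = ker res`
    obtain ⟨x, hx⟩ := hres_surj τ'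
    have hxmem : x ∈ ((A' ⊔ Subgroup.zpowers g : Subgroup (HqF ≃ₐ[Bi] HqF)) : Set (HqF ≃ₐ[Bi] HqF)) := by
      rw [hgen]; exact Subgroup.mem_top x
    rw [Subgroup.normal_mul] at hxmem
    obtain ⟨a, ha, z, hz, rfl⟩ := Set.mem_mul.mp hxmem
    obtain ⟨k, rfl⟩ := Subgroup.mem_zpowers_iff.mp hz
    have hresa : res a = 1 := by
      rw [hA'] at ha
      exact (MonoidHom.mem_ker).mp ha
    have hτ' : τ' = (res g) ^ k := by rw [← hx, map_mul, hresa, one_mul, map_zpow]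
    -- transport to `K`-automorphisms along the (injective) restriction-of-scalars hom
    let jK : ((κ.layer (n + t)) ≃ₐ[Bi] (κ.layer (n + t))) →* ((κ.layer (n + t)) ≃ₐ[K] (κ.layer (n + t))) :=
      { toFun := fun s => s.restrictScalars K
        map_one' := rfl
        map_mul' := fun _ _ => rfl }
    have hjτ : jK τ' = τ := AlgEquiv.ext fun _ => rfl
    have hjσ : jK (res g) = σ := by rw [hσdef, hres_apply]; rfl
    refine Subgroup.mem_zpowers_iff.mpr ⟨k, ?_⟩
    rw [← hjτ, hτ', map_zpow, hjσ]
  have hcount : Nat.card {a : A' // g * (a : HqF ≃ₐ[Bi] HqF) * g⁻¹ = a} =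
      p ^ padicValNat p (Nat.card {c : ClassGroup (𝓞 (κ.layer (n + t))) //
        ClassGroup.mulEquiv (AmbiguousClass.intAut σ) c = c}) := by
    have hA'card' : Nat.card A' = p ^ padicValNat p (Nat.card (ClassGroup (𝓞 (κ.layer (n + t))))) := by
      rw [hA'card, ← classNumberPExp_eq_padicValNat_classNumber κ (n + t), classNumberPExp_def]
    have h := natCard_fixed_eq_pow_padicValNat_card_fixed_classGroup p (B := Bi) (κ.layer (n + t)) HqF A' hmemA' hA'card' g
    have hint : AmbiguousClass.intAut σ = AmbiguousClass.intAut (g.restrictNormal (κ.layer (n + t))) := by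
      rw [hσdef]; rfl
    rw [hint]; exact h
  -- ### the layers (`Fukuda1994Thm1RankLayer.exists_layer`) and the package
  have hlayer : ∀ j, j ≤ t → ∃ Gj : Subgroup (HqF ≃ₐ[Bi] HqF), A' ≤ Gj ∧ Gj.index = p ^ j ∧
      (⁅Gj, Gj⁆ ⊔ ⨆ I ∈ 𝓘, I ⊓ Gj).relIndex Gj = p ^ classNumberPExp κ (n + j) ∧
      ((⁅Gj, Gj⁆ ⊔ ⨆ I ∈ 𝓘, I ⊓ Gj) ⊔ Subgroup.closure ((fun x : HqF ≃ₐ[Bi] HqF => x ^ p) '' (Gj : Set (HqF ≃ₐ[Bi] HqF)))).relIndex Gj =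
        p ^ classGroupPRank κ (n + j) := fun j hj =>
    exists_layer κ n t j hj Bi hBi hdegKB HqF hmax _ hdegHp A' hmemA' 𝓘 h𝓘def
  refine ⟨HqF ≃ₐ[Bi] HqF, inferInstance, inferInstance, A', hA'n, inferInstance, g, 𝓘, hgA, hgen, hA'index, h𝓘, hg𝓘, ?_,
    ⟨σ, hσfix, hσgen, hcount⟩, hlayer⟩
  rw [hA'card, classNumberPExp_eq_padicValNat_classNumber]

end Literature.NumberTheory.IwasawaTheory

end
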